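import Summits.QuantumFields.YangMills.Theorems.BalabanUVNodesN15TwoSpacingGluingNeumannKnitEntryThreeTwoGrid
import Summits.QuantumFields.YangMills.Theorems.BalabanUVNodesN15TwoSpacingGluingNeumannKnitRecord
import HarnessLib

/-!
# THE GLUING STEP AT TWO LATTICE SPACINGS, 87R: ENTRY 3 OF THE COVER's PARAMETRIX ON THE TORUS OF RECORD, TWO GRIDS — THE LOCAL COMMUTATOR ROW's DEFECT
# `𝔇([Σ∇′*∇′, M_{h′_k}]G′^{↑}(□_k), [Σ∇*∇, M_{h_k}]G^{↑}(□_k))` HAS THE RATE `(L^K)^{−1∕16}`, VOLUME FREE (dag-n15-w5 g5 for dag-n15-c's programme R; N15 = NE2, s1 «background-layer OPERATOR ingredient»)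

Cell `pub-ymgap`, seat `pub-ymgap-dag-n15-w5` (WIDTH SEAT w5 on node n15, g5; HUMAN RULING D-0062 ∕ director-ym R399 (3a); dag-n15-c g14's word «n15-w5 take 86R–88R»).
`--kind proof --supports stmt-QuantumFields-27366 --as helper`, COUNT-NEUTRAL.  Theorems only (0 `def`, 0 `sorry`).  Imports BY NAME FILE 88 `…NeumannKnitEntryThreeTwoGrid` (through it FILE 87
`commLapDefectConst_le`, FILE 77 `rpow_sixteenth_facts`, FILE 71 `hasMaj_idef_commOp_lapOp_comp_of_cut`, FILE 74 `coverFit_params` ∕ `hasMaj_idef_commOp_zero`, FILES 64–67 the partition's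
two-grid fits and cuts, FILE 72 `chiCube_coverCorner_eq_one_side` ∕ `coverXi_shift`, FILE 67 `coverXi_offset`) and FILE 73 `…NeumannKnitRecord` (`knitHR` ∕ `knitGR` ∕ `MP_eq_two_mul` ∕
`coverMargin_fit`; through it dag-n15-a's PROGRAMME P: P-IIb `hasMaj_chiCube_liftCubeG` ∕ `hasMaj_chiCube_grad_liftCubeG`, P-IId `hasMaj_chiCube_divAdjOut_liftCubeG_pair` ∕
`hasMaj_idef_chiCube_divAdjOut_liftCubeG`, P-IIc `hasMaj_idef_chiCube_liftCubeG` ∕ `hasMaj_idef_chiCube_grad_liftCubeG`); nothing in the tree is modified.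

WHAT.  Torus of record `M = MP (paramsOf d L m_T K hL)` (`M_ν = 2·L^{m_T−s}·L^s`), FILE 73's cover (partition `knitHR`, modulus `2L^{m_T−s}`, resolution `L^s`; lifted cubes `knitGR` of side
`L^{s+1}`), `D₃ = Σ_μ∇*_μ∇_μ` at the coarse spacing `L^{−K}` and the fine spacing `L^{−(K+r)}`, King's pairing `P`:
* ★★★ **`hasMaj_idef_commOp_lapOp_comp_knitGR`** — the TWO-SIDED two-grid defect of the LOCAL commutator row of each cube of the record cover,
  `𝔇([D₃′, M_{h′_k}]G′^{↑}(□_k), [D₃, M_{h_k}]G^{↑}(□_k)) ≤ 1_□1_□·C_r(L^K)^{−1∕16}·e^{−δd}` (`K ≥ 1`, `4 ≤ L^K`), `δ, C_r` free of `s, m_T, K, r, k`: FILE 71 `hasMaj_idef_commOp_lapOp_comp_of_cut`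
  at `W = 0` with the partition's plumbing at modulus `2L^{m_T−s}` (FILE 74 `coverFit_params`, FILES 64∕65 fits and cuts, `coverXi_shift`, `coverXi_offset`), programme P's coarse cut rows
  (P-IIb, P-IId) and cut defects (P-IIc, P-IId) of the lifted cubes, FILE 87's compression `commLapDefectConst_le`.
FILE 87 `hasMaj_idef_commOp_lapOp_comp_knitG`'s record twin; the `hDK` rows of 88R's assembly (next file `…RecordKnitEntryThreeTwoGrid`).

HONEST FRAMING ∕ LIMITS.  Block-majorant bookkeeping over LANDED rows at `U ≡ 1` (Neumann-by-images cubes lifted to the torus of record); no new analytic estimate.  Nothing of [B5]∕[B6]∕[B9]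
asserted ([B6] (2.133)–(2.136) p.247 shapes; [B9] Thm 3.14 pp.426–427 the difference template).  NE2⁺ NOT PRINTED, NOT proved; N15 NOT discharged; K3⁸ OPEN; counts of record UNMOVED
(typed 28∕28 · discharged 5∕27); one finite 𝕋⁴ at fixed ε per index — NOT infinite volume, NOT OS on ℝ⁴, NOT a mass gap, NOT Clay; R4 closes the conditional finite-𝕋⁴ rung
`BalabanLadder.UV` only.  No summit statement is proved here.  Restate-immune (no Theses import).
-/

noncomputable section

namespace Summit.QuantumFields.YangMills.BalabanUVNodes.N15.Gluing

open Real
open Literature.MathematicalPhysics.QuantumFieldTheory.Balaban1983to89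
open Literature.MathematicalPhysics.QuantumFieldTheory.Balaban1983to89.B5Prop11Plancherel (Tor fine)
open Literature.MathematicalPhysics.QuantumFieldTheory.Balaban1983to89.B11SectG (BlockNorm HasMaj RowSum)
open Literature.MathematicalPhysics.QuantumFieldTheory.Balaban1983to89.T4EtaRateDefect (idef idef_sub)
open Literature.MathematicalPhysics.QuantumFieldTheory.Balaban1983to89.T4EtaRateCoeffDefect (pull diagK hasMaj_mulOp hasMaj_idef_mulOp diagK_le_decay)
open Literature.MathematicalPhysics.QuantumFieldTheory.Balaban1983to89.B6Prop26Gluing (mulOp mulOp_apply ind ind_nonneg ind_le_one)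
open Literature.MathematicalPhysics.QuantumFieldTheory.Balaban1983to89.B6UnitTorusCarrier (unitTorusGeo triangle254_unitTorusGeo rowSum_unitTorusGeo unitTorusGeo_dist_nonneg
  unitTorusGeo_dist_self)
open Literature.MathematicalPhysics.QuantumFieldTheory.Balaban1983to89.B5SiteBridgeP12 (MP)
open Literature.MathematicalPhysics.QuantumFieldTheory.King1986.Torus (blockOf tdistT tdistT_nonneg)
open Summit.QuantumFields.YangMills.BalabanUVNodes.N15.VectorPiece (bshiftEquiv kingPrV blkFine blkFine_comp_kingPrV)
open Summit.QuantumFields.YangMills.BalabanUVNodes.N15.BackgroundLayer (fgrad fgradAdj bgrad symbOp_sD_eq)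
open Summit.QuantumFields.YangMills.BalabanUVNodes.N15.TwoGrid (paramsOf chiCube cubeBlocks liftCubeG MP_dvd_MP hasMaj_chiCube_liftCubeG hasMaj_chiCube_grad_liftCubeG
  hasMaj_chiCube_divAdjOut_liftCubeG_pair hasMaj_idef_chiCube_liftCubeG hasMaj_idef_chiCube_grad_liftCubeG hasMaj_idef_chiCube_divAdjOut_liftCubeG)

variable {d : ℕ} {L : ℕ} [NeZero L]

/-- ★★★ **THE TWO-SIDED TWO-GRID η-DEFECT OF THE LOCAL COMMUTATOR ROW OF EACH CUBE OF THE COVER ON THE TORUS OF RECORD**: for odd `L ≥ 3`, `a > 0` there are `δ, C_r > 0` — free of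
the cube exponent `s`, the volume exponent `m_T ≥ s + 1`, `K ≥ 1` (`4 ≤ L^K`), `r` and the cube index — with
`𝔇([Σ∇′*∇′, M_{h′_k}]G′^{↑}(□_k), [Σ∇*∇, M_{h_k}]G^{↑}(□_k)) ≤ 1_□(y)1_□(y′)·C_r(L^K)^{−1∕16}·e^{−δ|y−y′|_T}` (spacings `L^{−K}`, `L^{−(K+r)}` of `Tor(2L^{m_T})`, King's pairing) — FILE 71
`hasMaj_idef_commOp_lapOp_comp_of_cut` at `W = 0` with the record partition's plumbing (modulus `2L^{m_T−s}`, resolution `L^s`) and dag-n15-a's cut rows ∕ cut defects of the LIFTED cubes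
(programme P, uniform in the volume), compressed by FILE 87 `commLapDefectConst_le`. [cite: Balaban1984PropagatorsII, (2.133)–(2.136) p.247 (shapes + mechanism), (2.36)–(2.37) p.229,
p.238 (T_□); Balaban1985BackgroundPropagators, Thm 3.14 pp.426–427 (difference template); King1986, Prop. 3.9 (3.73) p.665 (rate shape)] -/
theorem hasMaj_idef_commOp_lapOp_comp_knitGR (hL : Odd L ∧ 1 < L) {a : ℝ} (ha : 0 < a) :
    ∃ δ Cr : ℝ, 0 < δ ∧ 0 < Cr ∧ ∀ (s mT K r : ℕ) (hs : s + 1 ≤ mT) (_hK : 1 ≤ K) (_hn4 : 4 ≤ L ^ K) (k : Fin (d + 1) → ZMod (2 * L ^ (mT - s))),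
      HasMaj (BlockNorm.ofBlocks (unitTorusGeo L K (MP (paramsOf d L mT K hL)))
          (fun b : Tor (fine (L ^ K) (MP (paramsOf d L mT K hL))) × Fin (d + 1) => blockOf (L ^ K) (MP (paramsOf d L mT K hL)) b.1))
        (BlockNorm.ofBlocks (unitTorusGeo L K (MP (paramsOf d L mT K hL)))
          (fun i : Tor (fine (L ^ r * L ^ K) (MP (paramsOf d L mT K hL))) × Fin (d + 1) => blockOf (L ^ r * L ^ K) (MP (paramsOf d L mT K hL)) i.1))
        (idef (pull (kingPrV L K r (MP (paramsOf d L mT K hL)))) (pull (kingPrV L K r (MP (paramsOf d L mT K hL))))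
          (commOp (lapOp ((L ^ r * L ^ K : ℕ) : ℝ) (bshiftEquiv (MP (paramsOf d L mT K hL)) (L ^ r * L ^ K)) 0) (knitHR d L s mT K (L ^ r * L ^ K) hL k) ∘ₗ
            knitGR d L s mT K (L ^ r * L ^ K) hL hs a k)
          (commOp (lapOp ((L ^ K : ℕ) : ℝ) (bshiftEquiv (MP (paramsOf d L mT K hL)) (L ^ K)) 0) (knitHR d L s mT K (L ^ K) hL k) ∘ₗ knitGR d L s mT K (L ^ K) hL hs a k))
        (fun y y' => ind ((cubeBlocks (MP (paramsOf d L mT K hL)) (coverCorner (MP (paramsOf d L mT K hL)) (L ^ s) (L ^ (mT - s)) (coverMargin L s) k) (L ^ (s + 1)) : Finset _) : Set _) y *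
          ind ((cubeBlocks (MP (paramsOf d L mT K hL)) (coverCorner (MP (paramsOf d L mT K hL)) (L ^ s) (L ^ (mT - s)) (coverMargin L s) k) (L ^ (s + 1)) : Finset _) : Set _) y' *
          (Cr * ((L ^ K : ℕ) : ℝ) ^ (-(1 / 16 : ℝ)) * Real.exp (-(δ * tdistT (MP (paramsOf d L mT K hL)) y y')))) := by
  have hL3 : 3 ≤ L := by obtain ⟨⟨j, hj⟩, h1⟩ := hL; omega
  have hLpos : 0 < L := by omega
  have hL1 : 1 ≤ L := hLpos
  have hLodd : Odd L := hL.1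
  have hL2 : 2 ≤ L := hL.2
  -- programme P's letters of the lifted cubes, all uniform in the volume
  obtain ⟨δG, βG, hδG, hβG, HG⟩ := hasMaj_chiCube_liftCubeG (d := d) hL ha
  obtain ⟨δD, βD, hδD, hβD, HD⟩ := hasMaj_chiCube_grad_liftCubeG (d := d) hL ha
  obtain ⟨δB, βB, hδB, hβB, HB⟩ := hasMaj_chiCube_divAdjOut_liftCubeG_pair (d := d) hL ha
  obtain ⟨δc, mc, hδc, hmc, HC⟩ := hasMaj_idef_chiCube_liftCubeG (d := d) hLodd hL2 ha (γ := 1 / 8) (by norm_num) (by norm_num)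
  obtain ⟨δe, me, hδe, hme, HE⟩ := hasMaj_idef_chiCube_grad_liftCubeG (d := d) hLodd hL2 ha
  obtain ⟨δh, mh, hδh, hmh, HH⟩ := hasMaj_idef_chiCube_divAdjOut_liftCubeG (d := d) hLodd hL2 ha
  set δ : ℝ := min (min δG (min δD δB)) (min δc (min δe δh)) with hδ_def
  have hδ : 0 < δ := lt_min (lt_min hδG (lt_min hδD hδB)) (lt_min hδc (lt_min hδe hδh))
  have hdG : δ ≤ δG := (min_le_left _ _).trans (min_le_left _ _)
  have hdD : δ ≤ δD := (min_le_left _ _).trans ((min_le_right _ _).trans (min_le_left _ _))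
  have hdB : δ ≤ δB := (min_le_left _ _).trans ((min_le_right _ _).trans (min_le_right _ _))
  have hdc : δ ≤ δc := (min_le_right _ _).trans (min_le_left _ _)
  have hde : δ ≤ δe := (min_le_right _ _).trans ((min_le_right _ _).trans (min_le_left _ _))
  have hdh : δ ≤ δh := (min_le_right _ _).trans ((min_le_right _ _).trans (min_le_right _ _))
  set β₁ : ℝ := max βD βB with hβ₁_def
  have hβ₁ : 0 ≤ β₁ := hβD.le.trans (le_max_left _ _)
  set mm : ℝ := max me mh with hmm_def
  have hmm : 0 ≤ mm := hme.le.trans (le_max_left _ _)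
  set Cr : ℝ := (d + 1 : ℕ) * (32 * π ^ 2 * mc + (144 * π ^ 3 + 32 * π ^ 3 * (d + 1 : ℕ)) * βG + 2 * (π * mm + (64 * π ^ 2 + π ^ 2 * (d + 1 : ℕ)) * β₁)) + 1 with hCr_def
  refine ⟨δ, Cr, hδ, by positivity, fun s mT K r hs hK hn4 k => ?_⟩
  -- the index's data
  set M : Fin (d + 1) → ℕ := MP (paramsOf d L mT K hL) with hMdef
  have hs' : s ≤ mT := by omega
  have hM : ∀ ν, M ν = 2 * L ^ (mT - s) * L ^ s := MP_eq_two_mul L s mT K hL hs'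
  have hw : 0 < L ^ s := pow_pos hLpos s
  have hq : 1 ≤ L ^ (mT - s) := Nat.one_le_pow _ _ hLpos
  haveI : NeZero (L ^ (mT - s)) := ⟨pow_ne_zero _ (NeZero.ne L)⟩
  have hn : 1 ≤ L ^ K := Nat.one_le_pow _ _ hLpos
  have hSe : L ^ (s + 1) = L * L ^ s := by rw [pow_succ, mul_comm]
  have hfit : 2 * coverMargin L s + 2 * L ^ s + 1 ≤ L ^ (s + 1) := by rw [hSe]; exact coverMargin_fit hL3 s
  have hfit1 : coverMargin L s + 2 * L ^ s + 1 ≤ L ^ (s + 1) := by omega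
  have hS : L ^ (s + 1) ≤ 2 * L ^ (mT - s) * L ^ s := by
    rw [← hM 0]
    show L ^ (s + 1) ≤ 2 * L ^ mT
    have := Nat.pow_le_pow_right hLpos hs
    omega
  have h3 : 3 ≤ L ^ K * L ^ s :=
    calc 3 ≤ L := hL3
      _ = L ^ 1 := (pow_one L).symm
      _ ≤ L ^ K := Nat.pow_le_pow_right hLpos hK
      _ = L ^ K * 1 := (mul_one _).symm
      _ ≤ L ^ K * L ^ s := Nat.mul_le_mul_left _ hw
  have hwR : (1 : ℝ) ≤ ((L ^ s : ℕ) : ℝ) := by exact_mod_cast hw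
  have hnR : (1 : ℝ) ≤ ((L ^ K : ℕ) : ℝ) := by exact_mod_cast hn
  set ε : ℝ := ((L ^ K : ℕ) : ℝ) ^ (-(1 / 16 : ℝ)) with hε_def
  obtain ⟨-, hnwε, -, hε0⟩ := rpow_sixteenth_facts hnR hwR
  have hexp16 : (-((1 : ℝ) / 8 / 2)) = -(1 / 16 : ℝ) := by norm_num
  have hblk : (fun i : Tor (fine (L ^ r * L ^ K) M) × Fin (d + 1) => blockOf (L ^ r * L ^ K) M i.1) = blkFine L K M ∘ kingPrV L K r M := (blkFine_comp_kingPrV (M := M) L K r).symm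
  set c : Tor M := coverCorner M (L ^ s) (L ^ (mT - s)) (coverMargin L s) k with hc_def
  have hind : ∀ y y' : Tor M, 0 ≤ ind (g := unitTorusGeo L K M) ((cubeBlocks M c (L ^ (s + 1)) : Finset (Tor M)) : Set (Tor M)) y *
      ind (g := unitTorusGeo L K M) ((cubeBlocks M c (L ^ (s + 1)) : Finset (Tor M)) : Set (Tor M)) y' := fun y y' => mul_nonneg (ind_nonneg _ _) (ind_nonneg _ _)
  -- coarse cut rows of the lifted cube (P-IIb, P-IId), rates weakened to `δ`
  have hGc : HasMaj (BlockNorm.ofBlocks (unitTorusGeo L K M) (blkFine L K M)) (BlockNorm.ofBlocks (unitTorusGeo L K M) (blkFine L K M))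
      (mulOp (chiCube M (L ^ K) c (L ^ (s + 1))) ∘ₗ knitGR d L s mT K (L ^ K) hL hs a k)
      (fun y y' => ind ((cubeBlocks M c (L ^ (s + 1)) : Finset (Tor M)) : Set (Tor M)) y * ind ((cubeBlocks M c (L ^ (s + 1)) : Finset (Tor M)) : Set (Tor M)) y' *
        (βG * Real.exp (-(δ * tdistT M y y')))) :=
    hasMaj_rate_le hind hβG.le hdG (HG (s + 1) mT K hs hK c)
  have hDc : ∀ μ, HasMaj (BlockNorm.ofBlocks (unitTorusGeo L K M) (blkFine L K M)) (BlockNorm.ofBlocks (unitTorusGeo L K M) (blkFine L K M))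
      (mulOp (chiCube M (L ^ K) c (L ^ (s + 1))) ∘ₗ (fgrad ((L ^ K : ℕ) : ℝ) (bshiftEquiv M (L ^ K) μ) ∘ₗ knitGR d L s mT K (L ^ K) hL hs a k))
      (fun y y' => ind ((cubeBlocks M c (L ^ (s + 1)) : Finset (Tor M)) : Set (Tor M)) y * ind ((cubeBlocks M c (L ^ (s + 1)) : Finset (Tor M)) : Set (Tor M)) y' *
        (β₁ * Real.exp (-(δ * tdistT M y y')))) := fun μ => by
    have h := HD (s + 1) mT K hs hK c μ
    rw [symbOp_sD_eq] at h
    exact (hasMaj_rate_le hind hβD.le hdD h).mono fun y y' => mul_le_mul_of_nonneg_left (mul_le_mul_of_nonneg_right (le_max_left _ _) (Real.exp_nonneg _)) (hind y y')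
  have hDbc : ∀ μ, HasMaj (BlockNorm.ofBlocks (unitTorusGeo L K M) (blkFine L K M)) (BlockNorm.ofBlocks (unitTorusGeo L K M) (blkFine L K M))
      (mulOp (chiCube M (L ^ K) c (L ^ (s + 1))) ∘ₗ (bgrad ((L ^ K : ℕ) : ℝ) (bshiftEquiv M (L ^ K) μ) ∘ₗ knitGR d L s mT K (L ^ K) hL hs a k))
      (fun y y' => ind ((cubeBlocks M c (L ^ (s + 1)) : Finset (Tor M)) : Set (Tor M)) y * ind ((cubeBlocks M c (L ^ (s + 1)) : Finset (Tor M)) : Set (Tor M)) y' *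
        (β₁ * Real.exp (-(δ * tdistT M y y')))) := fun μ => by
    have h := (HB (s + 1) mT K r hs hK c μ).1
    rw [bgrad_eq_neg_symbOp, LinearMap.neg_comp, LinearMap.comp_neg]
    exact ((hasMaj_rate_le hind hβB.le hdB h).mono fun y y' => mul_le_mul_of_nonneg_left (mul_le_mul_of_nonneg_right (le_max_right _ _) (Real.exp_nonneg _)) (hind y y')).neg
  -- cut defects of the lifted cube (P-IIc, P-IId), two-sided, fine blocks through the pairing
  have hIGc : HasMaj (BlockNorm.ofBlocks (unitTorusGeo L K M) (blkFine L K M)) (BlockNorm.ofBlocks (unitTorusGeo L K M) (blkFine L K M ∘ kingPrV L K r M))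
      (idef (pull (kingPrV L K r M)) (pull (kingPrV L K r M)) (mulOp (chiCube M (L ^ r * L ^ K) c (L ^ (s + 1))) ∘ₗ knitGR d L s mT K (L ^ r * L ^ K) hL hs a k)
        (mulOp (chiCube M (L ^ K) c (L ^ (s + 1))) ∘ₗ knitGR d L s mT K (L ^ K) hL hs a k))
      (fun y y' => ind ((cubeBlocks M c (L ^ (s + 1)) : Finset (Tor M)) : Set (Tor M)) y * ind ((cubeBlocks M c (L ^ (s + 1)) : Finset (Tor M)) : Set (Tor M)) y' *
        (mc * ε * Real.exp (-(δ * tdistT M y y')))) := by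
    have h := HC (s + 1) mT K r hK hL hs c
    rw [hexp16] at h
    have h2 := hasMaj_rate_le hind (by positivity : 0 ≤ mc * ε) hdc h
    rw [hblk] at h2
    exact h2
  have hIDc : ∀ μ, HasMaj (BlockNorm.ofBlocks (unitTorusGeo L K M) (blkFine L K M)) (BlockNorm.ofBlocks (unitTorusGeo L K M) (blkFine L K M ∘ kingPrV L K r M))
      (idef (pull (kingPrV L K r M)) (pull (kingPrV L K r M))
        (mulOp (chiCube M (L ^ r * L ^ K) c (L ^ (s + 1))) ∘ₗ (fgrad ((L ^ r * L ^ K : ℕ) : ℝ) (bshiftEquiv M (L ^ r * L ^ K) μ) ∘ₗ knitGR d L s mT K (L ^ r * L ^ K) hL hs a k))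
        (mulOp (chiCube M (L ^ K) c (L ^ (s + 1))) ∘ₗ (fgrad ((L ^ K : ℕ) : ℝ) (bshiftEquiv M (L ^ K) μ) ∘ₗ knitGR d L s mT K (L ^ K) hL hs a k)))
      (fun y y' => ind ((cubeBlocks M c (L ^ (s + 1)) : Finset (Tor M)) : Set (Tor M)) y * ind ((cubeBlocks M c (L ^ (s + 1)) : Finset (Tor M)) : Set (Tor M)) y' *
        (mm * ε * Real.exp (-(δ * tdistT M y y')))) := fun μ => by
    have h := HE (s + 1) mT K r hK hn4 hL hs c μ
    rw [symbOp_sD_eq, symbOp_sD_eq] at h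
    have h2 := (hasMaj_rate_le hind (by positivity : 0 ≤ me * ε) hde h).mono fun y y' =>
      mul_le_mul_of_nonneg_left (mul_le_mul_of_nonneg_right (mul_le_mul_of_nonneg_right (le_max_left me mh) hε0) (Real.exp_nonneg _)) (hind y y')
    rw [hblk] at h2
    exact h2
  have hIDbc : ∀ μ, HasMaj (BlockNorm.ofBlocks (unitTorusGeo L K M) (blkFine L K M)) (BlockNorm.ofBlocks (unitTorusGeo L K M) (blkFine L K M ∘ kingPrV L K r M))
      (idef (pull (kingPrV L K r M)) (pull (kingPrV L K r M))
        (mulOp (chiCube M (L ^ r * L ^ K) c (L ^ (s + 1))) ∘ₗ (bgrad ((L ^ r * L ^ K : ℕ) : ℝ) (bshiftEquiv M (L ^ r * L ^ K) μ) ∘ₗ knitGR d L s mT K (L ^ r * L ^ K) hL hs a k))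
        (mulOp (chiCube M (L ^ K) c (L ^ (s + 1))) ∘ₗ (bgrad ((L ^ K : ℕ) : ℝ) (bshiftEquiv M (L ^ K) μ) ∘ₗ knitGR d L s mT K (L ^ K) hL hs a k)))
      (fun y y' => ind ((cubeBlocks M c (L ^ (s + 1)) : Finset (Tor M)) : Set (Tor M)) y * ind ((cubeBlocks M c (L ^ (s + 1)) : Finset (Tor M)) : Set (Tor M)) y' *
        (mm * ε * Real.exp (-(δ * tdistT M y y')))) := fun μ => by
    have h := HH (s + 1) mT K r hK hn4 hL hs c μ
    rw [bgrad_eq_neg_symbOp, bgrad_eq_neg_symbOp, LinearMap.neg_comp, LinearMap.comp_neg, LinearMap.neg_comp, LinearMap.comp_neg, idef_neg]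
    have h2 := (hasMaj_rate_le hind (by positivity : 0 ≤ mh * ε) hdh h).mono fun y y' =>
      mul_le_mul_of_nonneg_left (mul_le_mul_of_nonneg_right (mul_le_mul_of_nonneg_right (le_max_right me mh) hε0) (Real.exp_nonneg _)) (hind y y')
    rw [hblk] at h2
    exact h2.neg
  -- the partition's plumbing at modulus `2L^{m_T−s}`, resolution `L^s` (FILE 74, FILES 64–67)
  obtain ⟨hs0, hs13, hs1', hs1, hsL, hnκ, hnκ'⟩ := coverFit_params (L := L) (kk := K) (r := r) (w := L ^ s) hL1 hw h3
  have hχ := fun μ => chiCube_coverCorner_eq_one_side (M := M) (n := L ^ K) (m₀ := coverMargin L s) hM hw hfit1 hS μ k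
  have hχ' := fun μ => chiCube_coverCorner_eq_one_side (M := M) (n := L ^ r * L ^ K) (m₀ := coverMargin L s) hM hw hfit1 hS μ k
  have hξ := fun μ ν b => coverXi_shift (n := L ^ K) hM hw μ ν b
  have hξ' := fun μ ν b => coverXi_shift (n := L ^ r * L ^ K) hM hw μ ν b
  have hoff := fun ν x' => coverXi_offset (M := M) (L := L) (kk := K) (r := r) (w := L ^ s) (q := L ^ (mT - s)) ν x'
  have hK2 : 2 ≤ 2 * L ^ (mT - s) := by omega
  have hLr : 1 ≤ L ^ r := Nat.one_le_pow _ _ hL1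
  -- FILE 71 at `W = 0`
  have key := hasMaj_idef_commOp_lapOp_comp_of_cut (g := unitTorusGeo L K M) (blkFine L K M) (kingPrV L K r M)
    (J := Fin (d + 1)) (e := bshiftEquiv M (L ^ K)) (e' := bshiftEquiv M (L ^ r * L ^ K)) (n := ((L ^ K : ℕ) : ℝ)) (n' := ((L ^ r * L ^ K : ℕ) : ℝ))
    (W := (0 : (Tor (fine (L ^ K) M) × Fin (d + 1) → ℝ) →ₗ[ℝ] (Tor (fine (L ^ K) M) × Fin (d + 1) → ℝ)))
    (W' := (0 : (Tor (fine (L ^ r * L ^ K) M) × Fin (d + 1) → ℝ) →ₗ[ℝ] (Tor (fine (L ^ r * L ^ K) M) × Fin (d + 1) → ℝ)))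
    (N := knitGR d L s mT K (L ^ K) hL hs a k) (N' := knitGR d L s mT K (L ^ r * L ^ K) hL hs a k) (h := knitHR d L s mT K (L ^ K) hL k) (h' := knitHR d L s mT K (L ^ r * L ^ K) hL k)
    (by positivity : (0 : ℝ) ≤ π / ((L ^ s : ℕ) : ℝ)) (by positivity : (0 : ℝ) ≤ 32 * π ^ 2 / (((L ^ s : ℕ) : ℝ)) ^ 2)
    (by positivity : (0 : ℝ) ≤ |((((L ^ s : ℕ) : ℝ)))⁻¹| * (((L ^ K : ℕ) : ℝ) * ((L ^ s : ℕ) : ℝ))⁻¹ * (64 * π ^ 2 + π ^ 2 * Fintype.card (Fin (d + 1))))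
    (by positivity : (0 : ℝ) ≤ ((((L ^ s : ℕ) : ℝ)))⁻¹ ^ 2 * (((L ^ K : ℕ) : ℝ) * ((L ^ s : ℕ) : ℝ))⁻¹ * (144 * π ^ 3 + 32 * π ^ 3 * Fintype.card (Fin (d + 1))))
    (fun μ x' => abs_fgrad_coverH_le hM hw k μ x') (fun μ x' => abs_bgrad_coverH_le hM hw k μ x') (fun μ x' => abs_fgradAdj_fgrad_coverH_le hM hw k μ x')
    (fun μ x' => abs_fgrad_hcube_two_grid_le (2 * L ^ (mT - s)) (coverXi M (L ^ K) (L ^ s)) (coverXi M (L ^ r * L ^ K) (L ^ s)) (kingPrV L K r M) (bshiftEquiv M (L ^ K))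
      (bshiftEquiv M (L ^ r * L ^ K)) hK2 hLr hs0 hs1' hsL hnκ hnκ' hξ hξ' hoff k μ x')
    (fun μ x' => abs_bgrad_hcube_two_grid_le (2 * L ^ (mT - s)) (coverXi M (L ^ K) (L ^ s)) (coverXi M (L ^ r * L ^ K) (L ^ s)) (kingPrV L K r M) (bshiftEquiv M (L ^ K))
      (bshiftEquiv M (L ^ r * L ^ K)) hK2 hLr hs0 hs1' hsL hnκ hnκ' hξ hξ' hoff k μ x')
    (fun μ x' => abs_fgradAdj_fgrad_hcube_two_grid_le (2 * L ^ (mT - s)) (coverXi M (L ^ K) (L ^ s)) (coverXi M (L ^ r * L ^ K) (L ^ s)) (kingPrV L K r M) (bshiftEquiv M (L ^ K))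
      (bshiftEquiv M (L ^ r * L ^ K)) hK2 hLr hs0 hs13 hs1 hsL hnκ hnκ' hξ hξ' hoff k μ x')
    (fun μ => fgradAdj_fgrad_hcube_cut (2 * L ^ (mT - s)) (coverXi M (L ^ K) (L ^ s)) (bshiftEquiv M (L ^ K)) μ _ (hχ μ))
    (fun μ => fgrad_hcube_cut (2 * L ^ (mT - s)) (coverXi M (L ^ K) (L ^ s)) (bshiftEquiv M (L ^ K)) μ _ (hχ μ))
    (fun μ => bgrad_hcube_cut (2 * L ^ (mT - s)) (coverXi M (L ^ K) (L ^ s)) (bshiftEquiv M (L ^ K)) μ _ (hχ μ))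
    (fun μ => fgradAdj_fgrad_hcube_cut (2 * L ^ (mT - s)) (coverXi M (L ^ r * L ^ K) (L ^ s)) (bshiftEquiv M (L ^ r * L ^ K)) μ _ (hχ' μ))
    (fun μ => fgrad_hcube_cut (2 * L ^ (mT - s)) (coverXi M (L ^ r * L ^ K) (L ^ s)) (bshiftEquiv M (L ^ r * L ^ K)) μ _ (hχ' μ))
    (fun μ => bgrad_hcube_cut (2 * L ^ (mT - s)) (coverXi M (L ^ r * L ^ K) (L ^ s)) (bshiftEquiv M (L ^ r * L ^ K)) μ _ (hχ' μ))
    hGc hDc hDbc hIGc hIDc hIDbc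
    (hasMaj_idef_commOp_zero (g := unitTorusGeo L K M) (blkFine L K M) (kingPrV L K r M) _ _ _ _ _ δ)
  rw [← hblk] at key
  refine key.mono fun y y' => mul_le_mul_of_nonneg_left (mul_le_mul_of_nonneg_right ?_ (Real.exp_nonneg _)) (hind y y')
  -- the compression (FILE 87)
  clear key hIDbc hIDc hIGc hDbc hDc hGc hξ hξ' hoff hχ hχ' HG HD HB HC HE HH hblk hind
  rw [Fintype.card_fin]
  have hs_eq : (((L ^ K : ℕ) : ℝ) * ((L ^ s : ℕ) : ℝ))⁻¹ ≤ ε := hnwε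
  have hcomp := commLapDefectConst_le d (β := βG) (β₁ := β₁) (mc := mc) (mm := mm) hwR (by positivity) hs_eq hε0 hβG.le hβ₁ hmc.le hmm
  refine hcomp.trans ?_
  rw [hCr_def, add_mul _ (1 : ℝ) ε, one_mul]
  exact le_add_of_nonneg_right hε0

end Summit.QuantumFields.YangMills.BalabanUVNodes.N15.Gluing

end
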